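import Literature.Topology.FourManifolds.SurgeryGlueData
import Literature.Topology.FourManifolds.BallStretch
import Literature.Topology.FourManifolds.SmoothEmbeddingComp
import HarnessLib

/-!
# Preliminaries for extracting reconstruction data from a surgery step

Elementary tools used to build a `SurgeryGlueData` (reconstruction datum, R. Hamilton,
*Four-manifolds with positive isotropic curvature*, Comm. Anal. Geom. 5 (1997) §1.1 pp. 3–4) out
of the pieces of a surgery step of the Ricci flow (Chen–Zhu 2006, Thm. 1.1 (iii)):

* `intervalStretch R` — a diffeomorphism of `ℝ` onto `(1 - R, R)` which is the identity on
  `[0, 1]` (`R > 1`), and the corresponding reparametrisation of tube charts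
  `𝕊ⁿ × ℝ → 𝕊ⁿ × (1-R, R)` (`tubeStretchPH`), so that a neck chart can be shrunk to any
  neighbourhood of the closed neck keeping the piece `ι (𝕊ⁿ × (0,1))` fixed
  (`IsSmoothEmbedding.comp_tubeStretch`);
* thickening lemmas: a continuous chart maps a thin shell around the unit sphere, a thin slab
  around a slice of a tube, a slightly larger closed ball, into any open set containing the image
  of the sphere, slice, closed unit ball (`exists_shell_subset_preimage`, …);
* a connected set covered by finitely many pairwise disjoint closed sets lies in one of them
  (`IsPreconnected.exists_subset_of_finite_disjoint_closed`);
* finitely many pairwise disjoint compact sets of a Hausdorff space have pairwise disjoint open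
  neighbourhoods (`exists_pairwise_disjoint_nhds_of_finite`).

## References

* R. S. Hamilton, *Four-manifolds with positive isotropic curvature*, Comm. Anal. Geom. 5 (1997)
  1–92, §1.1. [Hamilton1997]
-/

open scoped Manifold ContDiff Topology
open Set Function Metric Module Filter OpenPartialHomeomorph Topology

noncomputable section

namespace Literature.Topology.FourManifolds

/-! ### Stretching `ℝ` onto `(1 - R, R)` keeping `[0, 1]` fixed -/

section IntervalStretch

variable {R : ℝ}

/-- `σ_R t = 1 - s_R (1 - s_R t)` with `s_R = stretchProfileR R` (identity on `t ≤ 1`, squashing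
`[1, ∞)` onto `[1, R)`): the identity on `[0, 1]`, squashing `ℝ` onto `(1 - R, R)`. [folklore] -/
def intervalStretch (R t : ℝ) : ℝ := 1 - stretchProfileR R (1 - stretchProfileR R t)

/-- `σ t = s_R t` for `t ≥ 0`. [folklore] -/
theorem intervalStretch_of_nonneg (hR : 1 < R) {t : ℝ} (ht : 0 ≤ t) : intervalStretch R t = stretchProfileR R t := by
  rw [intervalStretch, stretchProfileR_of_le_one hR (by linarith [stretchProfileR_nonneg hR ht])]
  ring

/-- `σ t = t` on `[0, 1]`. [folklore] -/
theorem intervalStretch_of_mem_Icc (hR : 1 < R) {t : ℝ} (ht : t ∈ Icc (0 : ℝ) 1) : intervalStretch R t = t := by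
  rw [intervalStretch_of_nonneg hR ht.1, stretchProfileR_of_le_one hR ht.2]

/-- `σ t = 1 - s_R (1 - t)` for `t ≤ 1`. [folklore] -/
theorem intervalStretch_of_le_one (hR : 1 < R) {t : ℝ} (ht : t ≤ 1) : intervalStretch R t = 1 - stretchProfileR R (1 - t) := by
  rw [intervalStretch, stretchProfileR_of_le_one hR ht]

/-- `σ` is smooth. [folklore] -/
theorem contDiff_intervalStretch (hR : 1 < R) : ContDiff ℝ ∞ (intervalStretch R) :=
  contDiff_const.sub ((contDiff_stretchProfileR hR).comp (contDiff_const.sub (contDiff_stretchProfileR hR)))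

/-- `σ` is strictly increasing. [folklore] -/
theorem strictMono_intervalStretch (hR : 1 < R) : StrictMono (intervalStretch R) := fun a b hab => by
  unfold intervalStretch
  have h1 := strictMono_stretchProfileR hR hab
  have h2 : 1 - stretchProfileR R b < 1 - stretchProfileR R a := by linarith
  have h3 := strictMono_stretchProfileR hR h2
  linarith

/-- `σ` is injective. [folklore] -/
theorem injective_intervalStretch (hR : 1 < R) : Injective (intervalStretch R) := (strictMono_intervalStretch hR).injective

/-- `1 - R < σ t < R`. [folklore] -/
theorem intervalStretch_mem_Ioo (hR : 1 < R) (t : ℝ) : intervalStretch R t ∈ Ioo (1 - R) R := by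
  rcases le_or_gt 0 t with ht | ht
  · rw [intervalStretch_of_nonneg hR ht]
    exact ⟨by linarith [stretchProfileR_nonneg hR ht], stretchProfileR_lt hR t⟩
  · rw [intervalStretch_of_le_one hR (by linarith)]
    have h1 : 1 < stretchProfileR R (1 - t) := by
      have := strictMono_stretchProfileR hR (show (1 : ℝ) < 1 - t by linarith)
      rwa [stretchProfileR_of_le_one hR le_rfl] at this
    constructor <;> linarith [stretchProfileR_lt hR (1 - t)]

/-- `σ` is onto `(1 - R, R)`. [folklore] -/
theorem exists_intervalStretch_eq (hR : 1 < R) {s : ℝ} (hs : s ∈ Ioo (1 - R) R) : ∃ t, intervalStretch R t = s := by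
  rcases le_or_gt 0 s with h0 | h0
  · obtain ⟨t, ht0, ht⟩ := exists_stretchProfileR_eq hR h0 hs.2
    exact ⟨t, by rw [intervalStretch_of_nonneg hR ht0, ht]⟩
  · -- `s < 0`: solve `s_R (1 - t) = 1 - s` with `1 - s ∈ (1, R)`
    obtain ⟨u, -, hu⟩ := exists_stretchProfileR_eq hR (show (0 : ℝ) ≤ 1 - s by linarith) (by linarith [hs.1])
    have hu1 : 1 < u := by
      by_contra hle
      rw [stretchProfileR_of_le_one hR (not_lt.1 hle)] at hu
      linarith [not_lt.1 hle]
    refine ⟨1 - u, ?_⟩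
    rw [intervalStretch_of_le_one hR (by linarith), sub_sub_cancel, hu]
    ring

/-- `range σ = (1 - R, R)`. [folklore] -/
theorem range_intervalStretch (hR : 1 < R) : range (intervalStretch R) = Ioo (1 - R) R :=
  Subset.antisymm (range_subset_iff.2 (intervalStretch_mem_Ioo hR)) fun _ hs => exists_intervalStretch_eq hR hs

/-- The inverse of `σ`. [folklore] -/
def intervalStretchInv (R : ℝ) : ℝ → ℝ := invFun (intervalStretch R)

/-- `σ⁻¹ (σ t) = t`. [folklore] -/
theorem intervalStretchInv_intervalStretch (hR : 1 < R) (t : ℝ) : intervalStretchInv R (intervalStretch R t) = t :=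
  leftInverse_invFun (injective_intervalStretch hR) t

/-- `σ (σ⁻¹ s) = s` on `(1 - R, R)`. [folklore] -/
theorem intervalStretch_intervalStretchInv (hR : 1 < R) {s : ℝ} (hs : s ∈ Ioo (1 - R) R) :
    intervalStretch R (intervalStretchInv R s) = s := by
  obtain ⟨t, rfl⟩ := exists_intervalStretch_eq hR hs
  rw [intervalStretchInv_intervalStretch hR]

/-- `σ' > 0`. [folklore] -/
theorem deriv_intervalStretch_pos (hR : 1 < R) (t : ℝ) : 0 < deriv (intervalStretch R) t := by
  have hd := differentiable_stretchProfileR hR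
  have h1 : HasDerivAt (fun t => 1 - stretchProfileR R t) (0 - deriv (stretchProfileR R) t) t :=
    (hasDerivAt_const t (1 : ℝ)).sub (hd t).hasDerivAt
  have h2 : HasDerivAt (stretchProfileR R) (deriv (stretchProfileR R) (1 - stretchProfileR R t)) (1 - stretchProfileR R t) :=
    (hd _).hasDerivAt
  have h3 := h2.comp t h1
  have h4 : HasDerivAt (intervalStretch R) (0 - deriv (stretchProfileR R) (1 - stretchProfileR R t) * (0 - deriv (stretchProfileR R) t)) t :=
    (hasDerivAt_const t (1 : ℝ)).sub h3
  rw [h4.deriv]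
  have := deriv_stretchProfileR_pos hR t
  have := deriv_stretchProfileR_pos hR (1 - stretchProfileR R t)
  nlinarith

/-- `σ⁻¹` is smooth at the points of `(1 - R, R)`. [folklore] -/
theorem contDiffAt_intervalStretchInv (hR : 1 < R) {s : ℝ} (hs : s ∈ Ioo (1 - R) R) : ContDiffAt ℝ ∞ (intervalStretchInv R) s := by
  obtain ⟨t, rfl⟩ := exists_intervalStretch_eq hR hs
  exact contDiffAt_leftInverse_of_hasDerivAt (contDiff_intervalStretch hR).contDiffAt
    (((contDiff_intervalStretch hR).differentiable (by simp)) t).hasDerivAt (deriv_intervalStretch_pos hR t).ne' (by simp)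
    (leftInverse_invFun (injective_intervalStretch hR))

/-- **`σ` as a partial diffeomorphism of `ℝ`** with source `ℝ` and target `(1 - R, R)`. [folklore] -/
def intervalStretchPH (hR : 1 < R) : OpenPartialHomeomorph ℝ ℝ where
  toFun := intervalStretch R
  invFun := intervalStretchInv R
  source := univ
  target := Ioo (1 - R) R
  map_source' t _ := intervalStretch_mem_Ioo hR t
  map_target' _ _ := mem_univ _
  left_inv' t _ := intervalStretchInv_intervalStretch hR t
  right_inv' _ hs := intervalStretch_intervalStretchInv hR hs
  open_source := isOpen_univ
  open_target := isOpen_Ioo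
  continuousOn_toFun := (contDiff_intervalStretch hR).continuous.continuousOn
  continuousOn_invFun := fun _ hs => (contDiffAt_intervalStretchInv hR hs).continuousAt.continuousWithinAt

/-- `intervalStretchPH_apply`: elementary bookkeeping. [folklore] -/
@[simp] theorem intervalStretchPH_apply (hR : 1 < R) (t : ℝ) : intervalStretchPH hR t = intervalStretch R t := rfl

/-- `intervalStretchPH_source`: elementary bookkeeping. [folklore] -/
@[simp] theorem intervalStretchPH_source (hR : 1 < R) : (intervalStretchPH hR).source = univ := rfl

/-- `intervalStretchPH_target`: elementary bookkeeping. [folklore] -/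
@[simp] theorem intervalStretchPH_target (hR : 1 < R) : (intervalStretchPH hR).target = Ioo (1 - R) R := rfl

/-- `σ` is smooth as a partial diffeomorphism. [folklore] -/
theorem contMDiffOn_intervalStretchPH (hR : 1 < R) : ContMDiffOn 𝓘(ℝ, ℝ) 𝓘(ℝ, ℝ) ∞ (intervalStretchPH hR) (intervalStretchPH hR).source :=
  (contMDiff_iff_contDiff.2 (contDiff_intervalStretch hR)).contMDiffOn

/-- `σ⁻¹` is smooth on the target. [folklore] -/
theorem contMDiffOn_intervalStretchPH_symm (hR : 1 < R) :
    ContMDiffOn 𝓘(ℝ, ℝ) 𝓘(ℝ, ℝ) ∞ (intervalStretchPH hR).symm (intervalStretchPH hR).target := fun _ hs =>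
  (contMDiffAt_iff_contDiffAt.2 (contDiffAt_intervalStretchInv hR hs)).contMDiffWithinAt

end IntervalStretch

/-! ### Reparametrising tube charts -/

section TubeStretch

variable {E : Type*} [NormedAddCommGroup E] {R : ℝ}

/-- **The tube reparametrisation** `(θ, t) ↦ (θ, σ_R t)`, a partial diffeomorphism of `𝕊ⁿ × ℝ`
with source everything and target `𝕊ⁿ × (1 - R, R)`. [folklore] -/
def tubeStretchPH (hR : 1 < R) : OpenPartialHomeomorph (sphere (0 : E) 1 × ℝ) (sphere (0 : E) 1 × ℝ) :=
  (OpenPartialHomeomorph.refl _).prod (intervalStretchPH hR)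

/-- `tubeStretchPH_apply`: elementary bookkeeping. [folklore] -/
@[simp] theorem tubeStretchPH_apply (hR : 1 < R) (q : sphere (0 : E) 1 × ℝ) : tubeStretchPH hR q = (q.1, intervalStretch R q.2) := rfl

/-- `tubeStretchPH_source`: elementary bookkeeping. [folklore] -/
theorem tubeStretchPH_source (hR : 1 < R) : (tubeStretchPH (E := E) hR).source = univ := by
  simp [tubeStretchPH]

/-- `tubeStretchPH_target`: elementary bookkeeping. [folklore] -/
theorem tubeStretchPH_target (hR : 1 < R) : (tubeStretchPH (E := E) hR).target = univ ×ˢ Ioo (1 - R) R := by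
  simp [tubeStretchPH]

/-- Its range is the image of `𝕊ⁿ × (1 - R, R)`. [folklore] -/
theorem range_comp_tubeStretch (hR : 1 < R) {α : Type*} (ι : sphere (0 : E) 1 × ℝ → α) :
    range (ι ∘ tubeStretchPH (E := E) hR) = ι '' (univ ×ˢ Ioo (1 - R) R) := by
  rw [← tubeStretchPH_target hR]
  exact (tubeStretchPH (E := E) hR).range_comp_eq_image_target (tubeStretchPH_source hR) ι

/-- It agrees with `ι` on `𝕊ⁿ × [0, 1]`. [folklore] -/
theorem comp_tubeStretch_apply_of_mem_Icc (hR : 1 < R) {α : Type*} (ι : sphere (0 : E) 1 × ℝ → α) (θ : sphere (0 : E) 1) {t : ℝ}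
    (ht : t ∈ Icc (0 : ℝ) 1) : (ι ∘ tubeStretchPH (E := E) hR) (θ, t) = ι (θ, t) := by
  simp [intervalStretch_of_mem_Icc hR ht]

/-- Images of `𝕊ⁿ × S`, `S ⊆ [0, 1]`, are unchanged. [folklore] -/
theorem comp_tubeStretch_image_of_subset_Icc (hR : 1 < R) {α : Type*} (ι : sphere (0 : E) 1 × ℝ → α) {S : Set ℝ}
    (hS : S ⊆ Icc 0 1) : (ι ∘ tubeStretchPH (E := E) hR) '' (univ ×ˢ S) = ι '' (univ ×ˢ S) := by
  apply image_congr
  rintro ⟨θ, t⟩ ⟨-, ht⟩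
  exact comp_tubeStretch_apply_of_mem_Icc hR ι θ (hS ht)

/-- The image of `𝕊ⁿ × [0,1]ᶜ` under the reparametrised chart lies in the image of the thin
collars `𝕊ⁿ × ((1 - R, 0) ∪ (1, R))` under `ι`, in particular in `ι (𝕊ⁿ × (0,1)ᶜ)`. [folklore] -/
theorem comp_tubeStretch_image_compl_subset (hR : 1 < R) {α : Type*} (ι : sphere (0 : E) 1 × ℝ → α) :
    (ι ∘ tubeStretchPH (E := E) hR) '' (univ ×ˢ (Ioo (0 : ℝ) 1)ᶜ) ⊆ ι '' (univ ×ˢ ((Ioo (0 : ℝ) 1)ᶜ ∩ Ioo (1 - R) R)) := by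
  rintro _ ⟨⟨θ, t⟩, ⟨-, ht⟩, rfl⟩
  refine ⟨(θ, intervalStretch R t), ⟨mem_univ _, ?_, intervalStretch_mem_Ioo hR t⟩, rfl⟩
  intro hmem
  apply ht
  -- `σ t ∈ (0,1)` forces `t ∈ (0,1)` since `σ` is the identity on `[0,1]` and monotone
  have hm := strictMono_intervalStretch hR
  constructor
  · by_contra h0
    have := hm.monotone (not_lt.1 h0)
    rw [intervalStretch_of_mem_Icc hR ⟨le_rfl, zero_le_one⟩] at this
    linarith [hmem.1]
  · by_contra h1
    have := hm.monotone (not_lt.1 h1)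
    rw [intervalStretch_of_mem_Icc hR ⟨zero_le_one, le_rfl⟩] at this
    linarith [hmem.2]

variable [InnerProductSpace ℝ E] {n : ℕ} [Fact (finrank ℝ E = n + 1)]

/-- The tube reparametrisation is smooth. [folklore] -/
theorem contMDiffOn_tubeStretchPH (hR : 1 < R) :
    ContMDiffOn ((𝓡 n).prod 𝓘(ℝ, ℝ)) ((𝓡 n).prod 𝓘(ℝ, ℝ)) ∞ (tubeStretchPH (E := E) hR) (tubeStretchPH (E := E) hR).source := by
  rw [tubeStretchPH_source]
  exact (contMDiff_fst.prodMk ((contMDiff_iff_contDiff.2 (contDiff_intervalStretch hR)).comp contMDiff_snd)).contMDiffOn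

/-- Its inverse is smooth on the target. [folklore] -/
theorem contMDiffOn_tubeStretchPH_symm (hR : 1 < R) :
    ContMDiffOn ((𝓡 n).prod 𝓘(ℝ, ℝ)) ((𝓡 n).prod 𝓘(ℝ, ℝ)) ∞ (tubeStretchPH (E := E) hR).symm (tubeStretchPH (E := E) hR).target := by
  rw [tubeStretchPH_target]
  have h : ∀ q ∈ (univ ×ˢ Ioo (1 - R) R : Set (sphere (0 : E) 1 × ℝ)), (tubeStretchPH (E := E) hR).symm q = (q.1, intervalStretchInv R q.2) := by
    intro q _; rfl
  refine ContMDiffOn.congr (f := fun q : sphere (0 : E) 1 × ℝ => (q.1, intervalStretchInv R q.2)) ?_ h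
  refine contMDiffOn_fst.prodMk ?_
  intro q hq
  exact ((contMDiffAt_iff_contDiffAt.2 (contDiffAt_intervalStretchInv hR hq.2)).comp_contMDiffWithinAt q contMDiffWithinAt_snd)

variable {M : Type*} [TopologicalSpace M] [ChartedSpace E M]

/-- **A tube chart reparametrised by `σ_R` is a smooth embedding.** [folklore] -/
theorem _root_.Manifold.IsSmoothEmbedding.comp_tubeStretch {ι : sphere (0 : E) 1 × ℝ → M}
    (hι : Manifold.IsSmoothEmbedding ((𝓡 n).prod 𝓘(ℝ, ℝ)) 𝓘(ℝ, E) ∞ ι) (hR : 1 < R) :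
    Manifold.IsSmoothEmbedding ((𝓡 n).prod 𝓘(ℝ, ℝ)) 𝓘(ℝ, E) ∞ (ι ∘ tubeStretchPH (E := E) hR) :=
  hι.comp_openPartialHomeomorph _ (tubeStretchPH_source hR) (contMDiffOn_tubeStretchPH hR) (contMDiffOn_tubeStretchPH_symm hR)

end TubeStretch

/-! ### Thickening lemmas -/

section Thicken

variable {X : Type*} [TopologicalSpace X]

/-- **A continuous map sends a slightly larger open ball into any open set containing the image of
the closed unit ball.** [folklore] -/
theorem exists_closedBall_subset_preimage {E : Type*} [NormedAddCommGroup E] [InnerProductSpace ℝ E] [FiniteDimensional ℝ E]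
    {ι : E → X} (hι : Continuous ι) {W : Set X} (hW : IsOpen W) (h : ι '' closedBall 0 1 ⊆ W) :
    ∃ ε : ℝ, 0 < ε ∧ ι '' closedBall 0 (1 + ε) ⊆ W := by
  obtain ⟨R, hR, hRW⟩ := exists_ball_subset_of_closedBall_subset (hW.preimage hι) (image_subset_iff.1 h)
  refine ⟨(R - 1) / 2, by linarith, image_subset_iff.2 ((closedBall_subset_ball (by linarith)).trans hRW)⟩

/-- **A continuous map sends a thin shell into any open set containing the image of the unit
sphere.** [folklore] -/
theorem exists_shell_subset_preimage {E : Type*} [NormedAddCommGroup E] [NormedSpace ℝ E] [FiniteDimensional ℝ E]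
    {ι : E → X} (hι : Continuous ι) {W : Set X} (hW : IsOpen W) (h : ι '' sphere 0 1 ⊆ W) :
    ∃ ε : ℝ, 0 < ε ∧ ε < 1 ∧ ι '' shell ε ε ⊆ W := by
  obtain ⟨r, hr, hrW⟩ := (isCompact_sphere (0 : E) 1).exists_cthickening_subset_open (hW.preimage hι) (image_subset_iff.1 h)
  refine ⟨min r (1 / 2), lt_min hr (by norm_num), (min_le_right _ _).trans_lt (by norm_num), image_subset_iff.2 fun y hy => hrW ?_⟩
  rw [mem_cthickening_iff]
  have hy0 : y ≠ 0 := by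
    rintro rfl; rw [shell, mem_setOf_eq, norm_zero] at hy
    linarith [hy.1, min_le_right r (1 / 2)]
  have hmem : (‖y‖⁻¹ • y) ∈ sphere (0 : E) 1 := by
    rw [mem_sphere_zero_iff_norm, norm_smul, norm_inv, norm_norm, inv_mul_cancel₀ (norm_ne_zero_iff.2 hy0)]
  refine (Metric.infEDist_le_edist_of_mem hmem).trans ?_
  rw [edist_dist, dist_eq_norm]
  have : y - ‖y‖⁻¹ • y = (1 - ‖y‖⁻¹) • y := by rw [sub_smul, one_smul]
  rw [this, norm_smul, Real.norm_eq_abs]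
  have hcalc : |1 - ‖y‖⁻¹| * ‖y‖ = |‖y‖ - 1| := by
    rw [← abs_of_pos (norm_pos_iff.2 hy0), ← abs_mul, abs_of_pos (norm_pos_iff.2 hy0)]
    congr 1; field_simp
  rw [hcalc]
  apply ENNReal.ofReal_le_ofReal
  rw [abs_le]; rw [shell, mem_setOf_eq] at hy
  constructor <;> linarith [hy.1, hy.2, min_le_left r (1 / 2)]

/-- **A continuous tube chart sends a thin slab around a slice into any open set containing the
image of the slice.** [folklore] -/
theorem exists_slab_subset_preimage {S : Type*} [TopologicalSpace S] [CompactSpace S] {ι : S × ℝ → X} (hι : Continuous ι)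
    {W : Set X} (hW : IsOpen W) (h : ℝ) (hsub : ι '' (univ ×ˢ {h}) ⊆ W) :
    ∃ η : ℝ, 0 < η ∧ ι '' (univ ×ˢ Ioo (h - η) (h + η)) ⊆ W := by
  have hK : (univ : Set S) ×ˢ ({h} : Set ℝ) ⊆ ι ⁻¹' W := image_subset_iff.1 hsub
  obtain ⟨u, v, hu, hv, huniv, hhv, huv⟩ := generalized_tube_lemma isCompact_univ isCompact_singleton (hW.preimage hι) hK
  obtain ⟨η, hη, hηv⟩ := Metric.isOpen_iff.1 hv h (hhv rfl)
  refine ⟨η, hη, image_subset_iff.2 fun q hq => huv ⟨huniv (mem_univ _), hηv ?_⟩⟩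
  rw [mem_ball, Real.dist_eq, abs_lt]
  constructor <;> linarith [hq.2.1, hq.2.2]

end Thicken

/-! ### Connected sets and finite disjoint closed families -/

section FiniteFamily

variable {X : Type*} [TopologicalSpace X]

/-- **A preconnected set covered by finitely many pairwise disjoint closed sets lies in one of
them** (or is empty). [folklore] -/
theorem IsPreconnected.exists_subset_of_finite_disjoint_closed {ι : Type*} {s : Set X} (hs : IsPreconnected s) (hne : s.Nonempty)
    (I : Finset ι) (F : ι → Set X) (hF : ∀ i ∈ I, IsClosed (F i)) (hdisj : ∀ i ∈ I, ∀ j ∈ I, i ≠ j → Disjoint (F i) (F j))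
    (hcover : s ⊆ ⋃ i ∈ I, F i) : ∃ i ∈ I, s ⊆ F i := by
  classical
  induction I using Finset.induction_on with
  | empty =>
    obtain ⟨x, hx⟩ := hne
    simpa using hcover hx
  | @insert a I ha ih =>
    -- split `s` between `F a` and the (closed) union of the others
    have hrest : IsClosed (⋃ i ∈ I, F i) := isClosed_biUnion_finset fun i hi => hF i (Finset.mem_insert_of_mem hi)
    have hdisj' : Disjoint (F a) (⋃ i ∈ I, F i) := by
      rw [Set.disjoint_iUnion₂_right]
      intro i hi
      exact hdisj a (Finset.mem_insert_self a I) i (Finset.mem_insert_of_mem hi) (fun h => ha (h ▸ hi))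
    have hcover' : s ⊆ F a ∪ ⋃ i ∈ I, F i := by simpa [Finset.set_biUnion_insert] using hcover
    rcases isPreconnected_iff_subset_of_disjoint_closed.1 hs (F a) (⋃ i ∈ I, F i) (hF a (Finset.mem_insert_self a I)) hrest hcover'
      (by rw [Set.disjoint_iff_inter_eq_empty.1 hdisj', inter_empty]) with h | h
    · exact ⟨a, Finset.mem_insert_self a I, h⟩
    · obtain ⟨i, hi, hsub⟩ := ih (fun i hi => hF i (Finset.mem_insert_of_mem hi))
        (fun i hi j hj hij => hdisj i (Finset.mem_insert_of_mem hi) j (Finset.mem_insert_of_mem hj) hij) h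
      exact ⟨i, Finset.mem_insert_of_mem hi, hsub⟩

/-- **Finitely many pairwise disjoint compact sets of a Hausdorff space have pairwise disjoint open
neighbourhoods.** [folklore] -/
theorem exists_pairwise_disjoint_nhds_of_finite [T2Space X] {ι : Type*} [Finite ι] (K : ι → Set X) (hK : ∀ i, IsCompact (K i))
    (hdisj : Pairwise fun i j => Disjoint (K i) (K j)) :
    ∃ W : ι → Set X, (∀ i, IsOpen (W i)) ∧ (∀ i, K i ⊆ W i) ∧ Pairwise fun i j => Disjoint (W i) (W j) := by
  classical
  -- separate each ordered pair, then intersect over the other index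
  have hsep : ∀ p : {p : ι × ι // p.1 ≠ p.2}, ∃ UV : Set X × Set X, IsOpen UV.1 ∧ IsOpen UV.2 ∧ K p.1.1 ⊆ UV.1 ∧ K p.1.2 ⊆ UV.2 ∧
      Disjoint UV.1 UV.2 := fun p => by
    obtain ⟨U, V, hU, hV, hKU, hKV, hUV⟩ := SeparatedNhds.of_isCompact_isCompact (hK p.1.1) (hK p.1.2) (hdisj p.2)
    exact ⟨(U, V), hU, hV, hKU, hKV, hUV⟩
  choose UV hUV using hsep
  let W : ι → Set X := fun i =>
    (⋂ j : {j : ι // i ≠ j}, (UV ⟨(i, j.1), j.2⟩).1) ∩ ⋂ j : {j : ι // j ≠ i}, (UV ⟨(j.1, i), j.2⟩).2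
  refine ⟨W, fun i => ?_, fun i => ?_, ?_⟩
  · exact (isOpen_iInter_of_finite fun j : {j : ι // i ≠ j} => (hUV ⟨(i, j.1), j.2⟩).1).inter
      (isOpen_iInter_of_finite fun j : {j : ι // j ≠ i} => (hUV ⟨(j.1, i), j.2⟩).2.1)
  · exact subset_inter (subset_iInter fun j : {j : ι // i ≠ j} => (hUV ⟨(i, j.1), j.2⟩).2.2.1)
      (subset_iInter fun j : {j : ι // j ≠ i} => (hUV ⟨(j.1, i), j.2⟩).2.2.2.1)
  · intro i j hij
    refine Set.disjoint_left.2 fun x hxi hxj => ?_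
    have h1 : x ∈ (UV ⟨(i, j), hij⟩).1 := mem_iInter.1 hxi.1 ⟨j, hij⟩
    have h2 : x ∈ (UV ⟨(i, j), hij⟩).2 := mem_iInter.1 hxj.2 ⟨i, hij⟩
    exact Set.disjoint_left.1 (hUV ⟨(i, j), hij⟩).2.2.2.2 h1 h2

end FiniteFamily

end Literature.Topology.FourManifolds

end
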